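import Mathlib.LinearAlgebra.Matrix.Hermitian
import Mathlib.LinearAlgebra.Matrix.GeneralLinearGroup.Defs
import Mathlib.LinearAlgebra.Matrix.Determinant.Basic
import Mathlib.Analysis.Complex.Basic
import Mathlib.Analysis.Convex.Contractible
import Mathlib.Topology.Instances.Matrix
import Mathlib.Topology.Algebra.ConstMulAction
import HarnessLib

/-!
# The cone of positive definite binary Hermitian forms and the action of `GL₂(ℂ)`

Topic `NumberTheory/Automorphic`; namespace `Literature.NumberTheory.Automorphic`, grouping
sub-namespace `BianchiCone`.  Definitions with body and theorems; Mathlib only.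

The model of hyperbolic `3`-space used for the reduction theory of Bianchi groups
([ElstrodtGrunewaldMennicke1998, Ch. 1 §1.1–1.3]: positive definite binary Hermitian forms up to
scaling; [BorelSerre1973, §11] for the general symmetric space): the open CONE
`𝒫 = {H ∈ M₂(ℂ) Hermitian, positive definite}` in the real vector space `M₂(ℂ)`, on which
`GL₂(ℂ)` acts LINEARLY by `g • H = (g⁻¹)ᴴ H g⁻¹` (so that `(g • H)[g v] = H[v]` for the
Hermitian form `H[v] = vᴴ H v`).  Working with the cone rather than its projectivisation keeps
the action linear, so that convexity is preserved for free.  For `2 × 2` matrices everything is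
explicit in the entries `H = (p z; z̄ r)`:

* `qf H v = Re(vᴴ H v)`, `hdet H = p r - |z|²`, `cone = {H Hermitian | p > 0, p r - |z|² > 0}`;
* `qf_eq_completeSquare` — `H[v] = p |v₀ + (z/p) v₁|² + (hdet H / p) |v₁|²` (`p > 0`), whence
  `qf_pos` (`H[v] > 0` on the cone for `v ≠ 0`) and the description
  `mem_cone_iff_forall_qf_pos` of the cone by the positivity of the form;
* `convex_cone`, `one_mem_cone`, `contractibleSpace_cone`;
* `act g H = (g⁻¹)ᴴ H g⁻¹`: `act_one`, `act_mul`, `qf_act_mulVec` (`(g • H)[g v] = H[v]`),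
  `act_mem_cone`, the `MulAction (GL (Fin 2) ℂ) ↥cone` and its continuity
  (`ContinuousConstSMul`), `act_add`/`act_smul` (linearity), `det_act`.

## References

* J. Elstrodt, F. Grunewald, J. Mennicke, *Groups Acting on Hyperbolic Space*, Springer (1998),
  Ch. 1 §1.1–1.3 [ElstrodtGrunewaldMennicke1998].
* A. Borel, J.-P. Serre, *Corners and arithmetic groups*, Comment. Math. Helv. 48 (1973), §11
  [BorelSerre1973].
-/

noncomputable section

open Matrix Complex
open scoped MatrixGroups ComplexConjugate

namespace Literature.NumberTheory.Automorphic

namespace BianchiCone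

/-- `2 × 2` complex matrices. [folklore] -/
abbrev Mat : Type := Matrix (Fin 2) (Fin 2) ℂ

/-- Column vectors of length `2`. [folklore] -/
abbrev Vec : Type := Fin 2 → ℂ

/-! ### The Hermitian form, the determinant and the cone -/

/-- **The value of the Hermitian form** `H[v] = Re(vᴴ H v)` (real for Hermitian `H`).
[cite: ElstrodtGrunewaldMennicke1998, Ch. 1 §1.1] -/
def qf (H : Mat) (v : Vec) : ℝ :=
  (star v ⬝ᵥ (H *ᵥ v)).re

/-- **The (real) determinant** `p r - |z|²` of a Hermitian `H = (p z; z̄ r)`. [folklore] -/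
def hdet (H : Mat) : ℝ :=
  (H 0 0).re * (H 1 1).re - Complex.normSq (H 0 1)

/-- **The cone of positive definite binary Hermitian forms**: Hermitian with `p > 0` and
`p r - |z|² > 0`. [cite: ElstrodtGrunewaldMennicke1998, Ch. 1 §1.1] -/
def cone : Set Mat :=
  {H | H.IsHermitian ∧ 0 < (H 0 0).re ∧ 0 < hdet H}

/-- The off-diagonal entries of a Hermitian matrix are conjugate. [folklore] -/
theorem apply_one_zero_of_isHermitian {H : Mat} (hH : H.IsHermitian) : H 1 0 = conj (H 0 1) := by
  have h := hH.apply 1 0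
  rw [← h]
  rfl

/-- The diagonal entries of a Hermitian matrix are real. [folklore] -/
theorem im_apply_self_of_isHermitian {H : Mat} (hH : H.IsHermitian) (i : Fin 2) : (H i i).im = 0 := by
  have h := hH.apply i i
  have h' : conj (H i i) = H i i := h
  exact Complex.conj_eq_iff_im.1 h'

/-- **The Hermitian form in coordinates**: `H[v] = p|v₀|² + r|v₁|² + 2 Re(v̄₀ z v₁)`.
[cite: ElstrodtGrunewaldMennicke1998, Ch. 1 §1.1] -/
theorem qf_eq {H : Mat} (hH : H.IsHermitian) (v : Vec) :
    qf H v = (H 0 0).re * Complex.normSq (v 0) + (H 1 1).re * Complex.normSq (v 1) +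
      2 * (conj (v 0) * H 0 1 * v 1).re := by
  have h10 := apply_one_zero_of_isHermitian hH
  have h00 := im_apply_self_of_isHermitian hH 0
  have h11 := im_apply_self_of_isHermitian hH 1
  simp only [qf, dotProduct, mulVec, Fin.sum_univ_two, Pi.star_apply, h10]
  simp only [Complex.add_re, Complex.add_im, Complex.mul_re, Complex.mul_im, Complex.star_def,
    Complex.conj_re, Complex.conj_im, Complex.normSq_apply]
  rw [h00, h11]
  ring

/-- **Completing the square**: for `p = H₀₀ > 0`,
`H[v] = p |v₀ + (z/p) v₁|² + ((p r - |z|²)/p) |v₁|²`. [cite: ElstrodtGrunewaldMennicke1998, Ch. 1 §1.1] -/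
theorem qf_eq_completeSquare {H : Mat} (hH : H.IsHermitian) (hp : 0 < (H 0 0).re) (v : Vec) :
    qf H v = (H 0 0).re * Complex.normSq (v 0 + H 0 1 / (H 0 0).re * v 1) +
      hdet H / (H 0 0).re * Complex.normSq (v 1) := by
  rw [qf_eq hH, hdet]
  have hp' : (H 0 0).re ≠ 0 := hp.ne'
  simp only [Complex.normSq_apply, Complex.add_re, Complex.add_im, Complex.mul_re, Complex.mul_im,
    Complex.div_re, Complex.div_im, Complex.ofReal_re, Complex.ofReal_im, Complex.conj_re,
    Complex.conj_im]
  field_simp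
  ring

/-- **Positivity**: on the cone, `H[v] > 0` for `v ≠ 0`. [cite: ElstrodtGrunewaldMennicke1998, Ch. 1 §1.1] -/
theorem qf_pos {H : Mat} (hH : H ∈ cone) {v : Vec} (hv : v ≠ 0) : 0 < qf H v := by
  obtain ⟨hherm, hp, hd⟩ := hH
  rw [qf_eq_completeSquare hherm hp]
  by_cases h1 : v 1 = 0
  · have h0 : v 0 ≠ 0 := by
      intro h0
      apply hv
      funext i
      fin_cases i
      · exact h0
      · exact h1
    rw [h1, mul_zero, add_zero, map_zero, mul_zero, add_zero]
    exact mul_pos hp (Complex.normSq_pos.2 h0)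
  · have h2 : 0 < hdet H / (H 0 0).re * Complex.normSq (v 1) :=
      mul_pos (div_pos hd hp) (Complex.normSq_pos.2 h1)
    have h3 : 0 ≤ (H 0 0).re * Complex.normSq (v 0 + H 0 1 / (H 0 0).re * v 1) :=
      mul_nonneg hp.le (Complex.normSq_nonneg _)
    linarith

/-- `H[e₀] = p`. [folklore] -/
theorem qf_single_zero (H : Mat) : qf H (Pi.single 0 1) = (H 0 0).re := by
  simp [qf, dotProduct, mulVec, Fin.sum_univ_two]

/-- The test vector `(-z, p)`: `H[(-z, p)] = p · (p r - |z|²)` for Hermitian `H`. [folklore] -/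
theorem qf_test {H : Mat} (hH : H.IsHermitian) :
    qf H ![-(H 0 1), ((H 0 0).re : ℂ)] = (H 0 0).re * hdet H := by
  rw [qf_eq hH, hdet]
  simp only [Matrix.cons_val_zero, Matrix.cons_val_one, map_neg, Complex.neg_re, Complex.neg_im,
    Complex.mul_re, Complex.mul_im, Complex.conj_re, Complex.conj_im, Complex.ofReal_re,
    Complex.ofReal_im, Complex.normSq_apply]
  ring

/-- **The cone is the set of Hermitian matrices whose form is positive on non-zero vectors.**
[cite: ElstrodtGrunewaldMennicke1998, Ch. 1 §1.1] -/
theorem mem_cone_iff_forall_qf_pos (H : Mat) :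
    H ∈ cone ↔ H.IsHermitian ∧ ∀ v : Vec, v ≠ 0 → 0 < qf H v := by
  constructor
  · intro h
    exact ⟨h.1, fun v hv => qf_pos h hv⟩
  · rintro ⟨hherm, hpos⟩
    have hp : 0 < (H 0 0).re := by
      rw [← qf_single_zero]
      exact hpos _ (by simp)
    refine ⟨hherm, hp, ?_⟩
    have h := hpos ![-(H 0 1), ((H 0 0).re : ℂ)] (by
      intro h0
      have := congrFun h0 1
      simp only [Matrix.cons_val_one, Matrix.cons_val_fin_one, Pi.zero_apply,
        Complex.ofReal_eq_zero] at this
      exact hp.ne' this)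
    rw [qf_test hherm] at h
    exact pos_of_mul_pos_right h hp.le

/-- `qf` is additive in the matrix. [folklore] -/
theorem qf_add (H H' : Mat) (v : Vec) : qf (H + H') v = qf H v + qf H' v := by
  simp only [qf, add_mulVec, dotProduct_add, Complex.add_re]

/-- `qf` is homogeneous in the matrix for real scalars. [folklore] -/
theorem qf_smul (t : ℝ) (H : Mat) (v : Vec) : qf (t • H) v = t * qf H v := by
  have h : (t • H) *ᵥ v = (t : ℂ) • (H *ᵥ v) := by
    rw [← Complex.coe_smul, smul_mulVec]
  rw [qf, qf, h, dotProduct_smul, smul_eq_mul, Complex.mul_re, Complex.ofReal_re, Complex.ofReal_im,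
    zero_mul, sub_zero]

/-- Real multiples of Hermitian matrices are Hermitian. [folklore] -/
theorem isHermitian_smul_real {H : Mat} (hH : H.IsHermitian) (t : ℝ) : (t • H).IsHermitian := by
  unfold Matrix.IsHermitian
  rw [conjTranspose_smul, star_trivial, hH.eq]

/-- **The cone is convex.** [cite: BorelSerre1973, §11] -/
theorem convex_cone : Convex ℝ cone := by
  intro H hH H' hH' a b ha hb hab
  rw [mem_cone_iff_forall_qf_pos] at hH hH' ⊢
  refine ⟨(isHermitian_smul_real hH.1 a).add (isHermitian_smul_real hH'.1 b), fun v hv => ?_⟩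
  rw [qf_add, qf_smul, qf_smul]
  rcases ha.lt_or_eq with ha' | rfl
  · have := hH.2 v hv
    have := hH'.2 v hv
    nlinarith
  · rw [zero_add] at hab
    rw [hab, zero_mul, one_mul, zero_add]
    exact hH'.2 v hv

/-- The identity matrix lies in the cone. [folklore] -/
theorem one_mem_cone : (1 : Mat) ∈ cone := by
  refine ⟨isHermitian_one, ?_, ?_⟩
  · simp
  · simp [hdet]

/-- **The cone is contractible** (convex and non-empty). [cite: BorelSerre1973, §11] -/
instance contractibleSpace_cone : ContractibleSpace ↥cone :=
  convex_cone.contractibleSpace ⟨1, one_mem_cone⟩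

/-! ### The action of `GL₂(ℂ)` -/

/-- **The action** `g • H = (g⁻¹)ᴴ H g⁻¹` of `GL₂(ℂ)` on binary Hermitian forms (`(g • H)[g v] = H[v]`).
[cite: ElstrodtGrunewaldMennicke1998, Ch. 1 §1.3] -/
def act (g : GL (Fin 2) ℂ) (H : Mat) : Mat :=
  ((g⁻¹ : GL (Fin 2) ℂ) : Mat)ᴴ * H * ((g⁻¹ : GL (Fin 2) ℂ) : Mat)

/-- `1 • H = H`. [folklore] -/
theorem act_one (H : Mat) : act 1 H = H := by
  simp [act]

/-- `(g h) • H = g • (h • H)`. [folklore] -/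
theorem act_mul (g h : GL (Fin 2) ℂ) (H : Mat) : act (g * h) H = act g (act h H) := by
  rw [act, act, act, _root_.mul_inv_rev, Units.val_mul, conjTranspose_mul]
  simp only [Matrix.mul_assoc]

/-- The action is additive. [folklore] -/
theorem act_add (g : GL (Fin 2) ℂ) (H H' : Mat) : act g (H + H') = act g H + act g H' := by
  simp only [act, Matrix.mul_add, Matrix.add_mul]

/-- The action commutes with real scalars. [folklore] -/
theorem act_smul (g : GL (Fin 2) ℂ) (t : ℝ) (H : Mat) : act g (t • H) = t • act g H := by
  simp only [act, Matrix.mul_smul, Matrix.smul_mul]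

/-- The action preserves Hermitian matrices. [folklore] -/
theorem isHermitian_act (g : GL (Fin 2) ℂ) {H : Mat} (hH : H.IsHermitian) : (act g H).IsHermitian :=
  isHermitian_conjTranspose_mul_mul _ hH

/-- `g⁻¹ g = 1` on underlying matrices. [folklore] -/
theorem coe_inv_mul (g : GL (Fin 2) ℂ) : ((g⁻¹ : GL (Fin 2) ℂ) : Mat) * (g : Mat) = 1 := by
  rw [← Units.val_mul, inv_mul_cancel, Units.val_one]

/-- `g g⁻¹ = 1` on underlying matrices. [folklore] -/
theorem coe_mul_inv (g : GL (Fin 2) ℂ) : (g : Mat) * ((g⁻¹ : GL (Fin 2) ℂ) : Mat) = 1 := by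
  rw [← Units.val_mul, mul_inv_cancel, Units.val_one]

/-- **Invariance of the form**: `(g • H)[g v] = H[v]`. [cite: ElstrodtGrunewaldMennicke1998, Ch. 1 §1.3] -/
theorem qf_act_mulVec (g : GL (Fin 2) ℂ) (H : Mat) (v : Vec) :
    qf (act g H) ((g : Mat) *ᵥ v) = qf H v := by
  have h1 : ((g⁻¹ : GL (Fin 2) ℂ) : Mat) *ᵥ ((g : Mat) *ᵥ v) = v := by
    rw [mulVec_mulVec, coe_inv_mul, one_mulVec]
  have h2 : act g H *ᵥ ((g : Mat) *ᵥ v) = ((g⁻¹ : GL (Fin 2) ℂ) : Mat)ᴴ *ᵥ (H *ᵥ v) := by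
    rw [act, ← mulVec_mulVec, ← mulVec_mulVec, h1]
  have h3 : (g : Mat)ᴴ * ((g⁻¹ : GL (Fin 2) ℂ) : Mat)ᴴ = 1 := by
    rw [← conjTranspose_mul, coe_inv_mul, conjTranspose_one]
  rw [qf, qf, h2, dotProduct_mulVec, star_mulVec, vecMul_vecMul, h3, vecMul_one]

/-- `H[w] = (g • H)` evaluated at `w` is `H[g⁻¹ w]`. [folklore] -/
theorem qf_act (g : GL (Fin 2) ℂ) (H : Mat) (w : Vec) :
    qf (act g H) w = qf H (((g⁻¹ : GL (Fin 2) ℂ) : Mat) *ᵥ w) := by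
  conv_lhs => rw [show w = (g : Mat) *ᵥ (((g⁻¹ : GL (Fin 2) ℂ) : Mat) *ᵥ w) by
    rw [mulVec_mulVec, coe_mul_inv, one_mulVec]]
  exact qf_act_mulVec g H _

/-- **The action preserves the cone.** [cite: ElstrodtGrunewaldMennicke1998, Ch. 1 §1.3] -/
theorem act_mem_cone (g : GL (Fin 2) ℂ) {H : Mat} (hH : H ∈ cone) : act g H ∈ cone := by
  rw [mem_cone_iff_forall_qf_pos] at hH ⊢
  refine ⟨isHermitian_act g hH.1, fun w hw => ?_⟩
  rw [qf_act]
  refine hH.2 _ fun h0 => hw ?_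
  have h := congrArg (fun u => (g : Mat) *ᵥ u) h0
  simp only [mulVec_mulVec, coe_mul_inv, one_mulVec, mulVec_zero] at h
  exact h

/-- **The action of `GL₂(ℂ)` on the cone.** [cite: ElstrodtGrunewaldMennicke1998, Ch. 1 §1.3] -/
instance instMulActionCone : MulAction (GL (Fin 2) ℂ) ↥cone where
  smul g H := ⟨act g H, act_mem_cone g H.2⟩
  one_smul H := Subtype.ext (act_one H)
  mul_smul g h H := Subtype.ext (act_mul g h H)

/-- The underlying matrix of `g • H`. [folklore] -/
@[simp]
theorem coe_smul_cone (g : GL (Fin 2) ℂ) (H : ↥cone) : ((g • H : ↥cone) : Mat) = act g H :=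
  rfl

/-- The action map `H ↦ g • H` is continuous on matrices. [folklore] -/
theorem continuous_act (g : GL (Fin 2) ℂ) : Continuous (act g) :=
  (continuous_const.matrix_mul continuous_id).matrix_mul continuous_const

/-- **The action on the cone is by homeomorphisms.** [folklore] -/
instance continuousConstSMul_cone : ContinuousConstSMul (GL (Fin 2) ℂ) ↥cone :=
  ⟨fun g => ((continuous_act g).comp continuous_subtype_val).subtype_mk _⟩

/-- For Hermitian `H`, the complex determinant is the real determinant `p r - |z|²`. [folklore] -/
theorem det_eq_hdet {H : Mat} (hH : H.IsHermitian) : H.det = (hdet H : ℂ) := by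
  rw [det_fin_two, apply_one_zero_of_isHermitian hH, hdet]
  have h00 := im_apply_self_of_isHermitian hH 0
  have h11 := im_apply_self_of_isHermitian hH 1
  apply Complex.ext
  · simp only [Complex.sub_re, Complex.mul_re, Complex.ofReal_re, h00, h11, mul_zero, sub_zero,
      Complex.mul_conj]
  · simp only [Complex.sub_im, Complex.mul_im, Complex.ofReal_im, h00, h11, mul_zero, zero_mul,
      add_zero, Complex.mul_conj, sub_zero]

/-- **The determinant transforms by `|det g|⁻²`.** [cite: ElstrodtGrunewaldMennicke1998, Ch. 1 §1.3] -/
theorem det_act (g : GL (Fin 2) ℂ) (H : Mat) :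
    (act g H).det = H.det * ((Complex.normSq ((g : Mat).det) : ℂ))⁻¹ := by
  have hdg : ((g⁻¹ : GL (Fin 2) ℂ) : Mat).det = ((g : Mat).det)⁻¹ := by
    rw [← Matrix.GeneralLinearGroup.val_det_apply, map_inv, Units.val_inv_eq_inv_val,
      Matrix.GeneralLinearGroup.val_det_apply]
  rw [act, det_mul, det_mul, det_conjTranspose, hdg, ← Complex.mul_conj]
  simp only [star_inv₀, Complex.star_def, mul_inv]
  ring

/-- **The real determinant transforms by `|det g|⁻²`** (Hermitian `H`). [folklore] -/
theorem hdet_act (g : GL (Fin 2) ℂ) {H : Mat} (hH : H.IsHermitian) :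
    hdet (act g H) = hdet H / Complex.normSq ((g : Mat).det) := by
  have h := det_act g H
  rw [det_eq_hdet (isHermitian_act g hH), det_eq_hdet hH] at h
  apply Complex.ofReal_injective
  rw [h, Complex.ofReal_div, div_eq_mul_inv]

end BianchiCone

end Literature.NumberTheory.Automorphic
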